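import Summits.AtomisticToContinuum.Crystallization.Theorems.FrustratedLawDichotomyStrainedPatchHomEntryFitHcpSharpKit

/-!
# Real side of a CENTRED (first-order exact) fit enclosure: second-order norm expansions and the pair-residual bound
# (27623 `(H) HomFloor (1/625)`, hcp half; critic row 1147 budget gate branch 3 «sharpen the inner leaf»; hand-1 g30 FINDING §3 (iii))

decomp-a2c hand-1 g30 (crux `AperiodicFrustratedLawGap`, stmt-AtomisticToContinuum-27623).  The kernel tolerance map (`…HomEntryFitToleranceA/B`) and its float
decomposition show that the interval excess of the pair misfit in `…HomEntryFitHcpSharpKit.fitOKHS` is `≈ 9` (misfit per unit entry half-width) against the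
true `l¹` gradient `2.27`: the natural interval evaluation of `‖R_k − δ_{k'} n_k‖²` cannot see that the residual `R_k` and the scale `δ_{k'} = ‖N_{k'}‖ − λ` move
TOGETHER under a change of `U` (a dilation changes neither the misfit nor, to first order, the pair residual along its own direction).  A centred leaf evaluates
the residual `r_c` at the cell centre and bounds `‖r_c + Δ‖` by the FIRST-ORDER functional `⟪ê, Δ⟫` (`ê = r_c/‖r_c‖`) — whose maximum over a box is the exact
`l¹` sum of its coefficients — plus explicit second-order remainders.  This file is the def-free real side the kernel kit will instantiate:

* §1 `norm_add_ge_inner` (`‖a‖ + ⟪a, Δ⟫/‖a‖ ≤ ‖a + Δ‖`), ★ `norm_add_le_inner_add_sq` (`‖a + Δ‖ ≤ ‖a‖ + ⟪a, Δ⟫/‖a‖ + ‖Δ‖²/(2(‖a‖ − ‖Δ‖))` for `‖Δ‖ < ‖a‖`);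
* §2 ★★ `pairResidual_le`: for the pair residual `r = R − (‖N‖ − λ)·n` (`‖n‖ = 1`) about centre data `R_c, N_c` with `ΔR = R − R_c`, `ΔN = N − N_c`,
  `‖r‖ ≤ ‖r_c‖ + (⟪ê, ΔR⟫ − ⟪ê, n⟫·⟪ĝ, ΔN⟫) + |⟪ê, n⟫|·‖ΔN‖²/(2(‖N_c‖ − ‖ΔN‖)) + (‖ΔR‖ + ‖ΔN‖)²/(2(‖r_c‖ − ‖ΔR‖ − ‖ΔN‖))`
  (`ê = r_c/‖r_c‖`, `ĝ = N_c/‖N_c‖`), valid when `‖ΔR‖ + ‖ΔN‖ < ‖r_c‖` and `‖ΔN‖ < ‖N_c‖` — the bracket is LINEAR in `(ΔR, ΔN)`, hence in the cell offsets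
  `(ΔU, Δξ)` up to the bilinear `ΔU Δξ` term of `…HomEntryFitHcpSharpKit.rReal`.

Def-free; 0 sorry; standard axioms; no instances / notation / `#eval`.  `--supports stmt-AtomisticToContinuum-27623`.
-/

namespace Summit.AtomisticToContinuum.Crystallization.Theorems.FrustratedLawDichotomyStrainedPatchHomEntryFitCentredReal

open scoped RealInnerProductSpace
open Summit.AtomisticToContinuum.Crystallization.Theorems.ChargedEnergyGapNegative (E3)

/-! ## §1. Second-order expansions of the norm about a non-zero centre -/

/-- First-order LOWER bound of the norm about `a ≠ 0`: `‖a‖ + ⟪a, Δ⟫/‖a‖ ≤ ‖a + Δ‖`. [folklore: Cauchy–Schwarz] -/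
theorem norm_add_ge_inner (a Δ : E3) (ha : a ≠ 0) : ‖a‖ + ⟪a, Δ⟫ / ‖a‖ ≤ ‖a + Δ‖ := by
  have hpos : 0 < ‖a‖ := norm_pos_iff.2 ha
  have hcs : ⟪a, a + Δ⟫ ≤ ‖a‖ * ‖a + Δ‖ := real_inner_le_norm _ _
  have hsplit : ⟪a, a + Δ⟫ = ‖a‖ ^ 2 + ⟪a, Δ⟫ := by
    rw [inner_add_right, real_inner_self_eq_norm_sq]
  rw [hsplit] at hcs
  have key : ‖a‖ * (‖a‖ + ⟪a, Δ⟫ / ‖a‖) ≤ ‖a‖ * ‖a + Δ‖ := by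
    have e : ‖a‖ * (‖a‖ + ⟪a, Δ⟫ / ‖a‖) = ‖a‖ ^ 2 + ⟪a, Δ⟫ := by
      rw [mul_add, mul_div_cancel₀ _ hpos.ne']
      ring
    rw [e]
    exact hcs
  exact le_of_mul_le_mul_left key hpos

/-- `X² ≤ A² + B ⟹ X ≤ A + B/(2A)` for `A > 0`, `B ≥ 0`. [arithmetic] -/
theorem le_add_div_of_sq_le {X A B : ℝ} (hA : 0 < A) (hB : 0 ≤ B) (h : X ^ 2 ≤ A ^ 2 + B) : X ≤ A + B / (2 * A) := by
  have hrhs : 0 ≤ A + B / (2 * A) := by positivity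
  have hsq : X ^ 2 ≤ (A + B / (2 * A)) ^ 2 := by
    have e : (A + B / (2 * A)) ^ 2 = A ^ 2 + B + (B / (2 * A)) ^ 2 := by
      field_simp
      ring
    rw [e]
    nlinarith [sq_nonneg (B / (2 * A))]
  exact (abs_le_of_sq_le_sq' hsq hrhs).2

/-- ★ Second-order UPPER bound of the norm about `a`: `‖a + Δ‖ ≤ ‖a‖ + ⟪a, Δ⟫/‖a‖ + ‖Δ‖²/(2(‖a‖ − ‖Δ‖))` when `‖Δ‖ < ‖a‖`. [folklore] -/
theorem norm_add_le_inner_add_sq (a Δ : E3) (hlt : ‖Δ‖ < ‖a‖) :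
    ‖a + Δ‖ ≤ ‖a‖ + ⟪a, Δ⟫ / ‖a‖ + ‖Δ‖ ^ 2 / (2 * (‖a‖ - ‖Δ‖)) := by
  have hΔ := norm_nonneg Δ
  have hpos : 0 < ‖a‖ := lt_of_le_of_lt hΔ hlt
  have hne : ‖a‖ ≠ 0 := hpos.ne'
  -- `|⟪a, Δ⟫| ≤ ‖a‖‖Δ‖`
  have hcs := abs_real_inner_le_norm a Δ
  have hlo : -(‖a‖ * ‖Δ‖) ≤ ⟪a, Δ⟫ := by
    have := neg_abs_le ⟪a, Δ⟫; linarith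
  set A : ℝ := ‖a‖ + ⟪a, Δ⟫ / ‖a‖ with hAdef
  have hAlo : ‖a‖ - ‖Δ‖ ≤ A := by
    have : -‖Δ‖ ≤ ⟪a, Δ⟫ / ‖a‖ := by
      rw [le_div_iff₀ hpos]; linarith
    rw [hAdef]; linarith
  have hA : 0 < A := lt_of_lt_of_le (by linarith) hAlo
  -- `‖a + Δ‖² = A² + ‖Δ‖² − ⟪a,Δ⟫²/‖a‖² ≤ A² + ‖Δ‖²`
  have hsq : ‖a + Δ‖ ^ 2 ≤ A ^ 2 + ‖Δ‖ ^ 2 := by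
    have e1 : ‖a + Δ‖ ^ 2 = ‖a‖ ^ 2 + 2 * ⟪a, Δ⟫ + ‖Δ‖ ^ 2 := norm_add_sq_real a Δ
    have e2 : A ^ 2 = ‖a‖ ^ 2 + 2 * ⟪a, Δ⟫ + (⟪a, Δ⟫ / ‖a‖) ^ 2 := by
      rw [hAdef]; field_simp; ring
    rw [e1, e2]
    nlinarith [sq_nonneg (⟪a, Δ⟫ / ‖a‖)]
  have h1 := le_add_div_of_sq_le hA (sq_nonneg ‖Δ‖) hsq
  -- monotonicity of the remainder in `A ≥ ‖a‖ − ‖Δ‖ > 0`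
  have h2 : ‖Δ‖ ^ 2 / (2 * A) ≤ ‖Δ‖ ^ 2 / (2 * (‖a‖ - ‖Δ‖)) := by
    apply div_le_div_of_nonneg_left (sq_nonneg _) (by linarith) (by linarith)
  linarith

/-! ## §2. ★★ The pair-residual bound -/

/-- ★★ **FIRST-ORDER-EXACT BOUND OF THE PAIR RESIDUAL.**  With `r := R − (‖N‖ − λ)·n`, `r_c := R_c − (‖N_c‖ − λ)·n`, `ΔR := R − R_c`, `ΔN := N − N_c`, `‖n‖ = 1`,
`r_c ≠ 0`-quantitatively (`‖ΔR‖ + ‖ΔN‖ < ‖r_c‖`) and `‖ΔN‖ < ‖N_c‖`: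
`‖r‖ ≤ ‖r_c‖ + (⟪r_c, ΔR⟫/‖r_c‖ − (⟪r_c, n⟫/‖r_c‖)·(⟪N_c, ΔN⟫/‖N_c‖)) + |⟪r_c, n⟫/‖r_c‖|·‖ΔN‖²/(2(‖N_c‖ − ‖ΔN‖)) + (‖ΔR‖ + ‖ΔN‖)²/(2(‖r_c‖ − ‖ΔR‖ − ‖ΔN‖))`.
[folklore chaining of §1] -/
theorem pairResidual_le (R Rc N Nc n : E3) (lam : ℝ) (hn : ‖n‖ = 1) (hsmall : ‖R - Rc‖ + ‖N - Nc‖ < ‖Rc - (‖Nc‖ - lam) • n‖) (hN : ‖N - Nc‖ < ‖Nc‖) :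
    ‖R - (‖N‖ - lam) • n‖ ≤
      ‖Rc - (‖Nc‖ - lam) • n‖ +
        (⟪Rc - (‖Nc‖ - lam) • n, R - Rc⟫ / ‖Rc - (‖Nc‖ - lam) • n‖ -
          ⟪Rc - (‖Nc‖ - lam) • n, n⟫ / ‖Rc - (‖Nc‖ - lam) • n‖ * (⟪Nc, N - Nc⟫ / ‖Nc‖)) +
        |⟪Rc - (‖Nc‖ - lam) • n, n⟫ / ‖Rc - (‖Nc‖ - lam) • n‖| * (‖N - Nc‖ ^ 2 / (2 * (‖Nc‖ - ‖N - Nc‖))) +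
        (‖R - Rc‖ + ‖N - Nc‖) ^ 2 / (2 * (‖Rc - (‖Nc‖ - lam) • n‖ - (‖R - Rc‖ + ‖N - Nc‖))) := by
  set rc : E3 := Rc - (‖Nc‖ - lam) • n with hrc
  set ΔR : E3 := R - Rc with hΔR
  set ΔN : E3 := N - Nc with hΔN
  set dδ : ℝ := ‖N‖ - ‖Nc‖ with hdδ
  set Δ : E3 := ΔR - dδ • n with hΔ
  have hΔR0 := norm_nonneg ΔR
  have hΔN0 := norm_nonneg ΔN
  have hrc_pos : 0 < ‖rc‖ := lt_of_le_of_lt (by positivity) hsmall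
  have hNc_pos : 0 < ‖Nc‖ := lt_of_le_of_lt hΔN0 hN
  -- the decomposition `r = r_c + Δ`
  have hdecomp : R - (‖N‖ - lam) • n = rc + Δ := by
    simp only [hrc, hΔ, hΔR, hdδ, sub_smul]
    abel
  -- `|dδ| ≤ ‖ΔN‖` and the two-sided expansion of `dδ`
  have hNe : N = Nc + ΔN := by simp [hΔN]
  have hdδ_abs : |dδ| ≤ ‖ΔN‖ := by
    rw [hdδ, hNe]
    have := abs_norm_sub_norm_le (Nc + ΔN) Nc
    simpa using this
  have hdδ_lo : ⟪Nc, ΔN⟫ / ‖Nc‖ ≤ dδ := by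
    have := norm_add_ge_inner Nc ΔN (norm_pos_iff.1 hNc_pos)
    rw [hdδ, hNe]; linarith
  have hdδ_hi : dδ ≤ ⟪Nc, ΔN⟫ / ‖Nc‖ + ‖ΔN‖ ^ 2 / (2 * (‖Nc‖ - ‖ΔN‖)) := by
    have := norm_add_le_inner_add_sq Nc ΔN hN
    rw [hdδ, hNe]; linarith
  -- `‖Δ‖ ≤ ‖ΔR‖ + ‖ΔN‖`
  have hΔle : ‖Δ‖ ≤ ‖ΔR‖ + ‖ΔN‖ := by
    calc ‖Δ‖ ≤ ‖ΔR‖ + ‖dδ • n‖ := norm_sub_le _ _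
      _ = ‖ΔR‖ + |dδ| := by rw [norm_smul, Real.norm_eq_abs, hn, mul_one]
      _ ≤ ‖ΔR‖ + ‖ΔN‖ := by linarith
  have hΔlt : ‖Δ‖ < ‖rc‖ := lt_of_le_of_lt hΔle hsmall
  -- second-order expansion about `r_c`
  have hmain := norm_add_le_inner_add_sq rc Δ hΔlt
  -- the first-order term: `⟪rc, Δ⟫ = ⟪rc, ΔR⟫ − dδ ⟪rc, n⟫`
  have hinner : ⟪rc, Δ⟫ = ⟪rc, ΔR⟫ - dδ * ⟪rc, n⟫ := by
    rw [hΔ, inner_sub_right, real_inner_smul_right]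
  -- bound `−dδ ⟪ê, n⟫ ≤ −⟪ê,n⟫⟪ĝ,ΔN⟫ + |⟪ê,n⟫| ρ²/(2(‖N_c‖ − ρ))`
  set en : ℝ := ⟪rc, n⟫ / ‖rc‖ with hen
  set q : ℝ := ‖ΔN‖ ^ 2 / (2 * (‖Nc‖ - ‖ΔN‖)) with hq
  have hq0 : 0 ≤ q := by rw [hq]; apply div_nonneg (sq_nonneg _); linarith
  have hfirst : -(dδ * en) ≤ -(en * (⟪Nc, ΔN⟫ / ‖Nc‖)) + |en| * q := by
    -- `dδ = g + θ q` with `θ ∈ [0,1]`-type two-sided bound: case on the sign of `en`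
    rcases le_or_gt 0 en with hpos | hneg
    · rw [abs_of_nonneg hpos]
      nlinarith [hdδ_lo, hpos, hq0]
    · rw [abs_of_neg hneg]
      nlinarith [hdδ_hi, hneg, hq0]
  -- remainder monotonicity: `‖Δ‖²/(2(‖rc‖ − ‖Δ‖)) ≤ (‖ΔR‖+‖ΔN‖)²/(2(‖rc‖ − ‖ΔR‖ − ‖ΔN‖))`
  have hrem : ‖Δ‖ ^ 2 / (2 * (‖rc‖ - ‖Δ‖)) ≤ (‖ΔR‖ + ‖ΔN‖) ^ 2 / (2 * (‖rc‖ - (‖ΔR‖ + ‖ΔN‖))) := by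
    have hd1 : 0 < 2 * (‖rc‖ - (‖ΔR‖ + ‖ΔN‖)) := by linarith
    have hd2 : 0 < 2 * (‖rc‖ - ‖Δ‖) := by linarith
    calc ‖Δ‖ ^ 2 / (2 * (‖rc‖ - ‖Δ‖)) ≤ ‖Δ‖ ^ 2 / (2 * (‖rc‖ - (‖ΔR‖ + ‖ΔN‖))) :=
          div_le_div_of_nonneg_left (sq_nonneg _) hd1 (by linarith)
      _ ≤ (‖ΔR‖ + ‖ΔN‖) ^ 2 / (2 * (‖rc‖ - (‖ΔR‖ + ‖ΔN‖))) :=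
          div_le_div_of_nonneg_right (pow_le_pow_left₀ (norm_nonneg _) hΔle 2) hd1.le
  -- assemble
  rw [hdecomp]
  have e1 : ⟪rc, Δ⟫ / ‖rc‖ = ⟪rc, ΔR⟫ / ‖rc‖ - dδ * en := by
    rw [hinner, hen, sub_div, mul_div_assoc]
  rw [e1] at hmain
  linarith [hmain, hfirst, hrem]

end Summit.AtomisticToContinuum.Crystallization.Theorems.FrustratedLawDichotomyStrainedPatchHomEntryFitCentredReal
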